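import Literature.Geometry.Kaehler.ComplexTorusThetaDivisorComponentsProductFamily
import Literature.Geometry.Kaehler.ComplexTorusThetaDivisorIrreducible
import Literature.Geometry.Kaehler.ComplexTorusHypersurfaceDescent
import Literature.Geometry.Kaehler.ComplexTorusPolarizedDecompositionExponent
import Literature.Geometry.Kaehler.ComplexTorusAverage
import HarnessLib

/-!
# The factors cut out by the components of the theta divisor are irreducible, and the components are
# in bijection with the irreducible factors of the p.p.a.v. (Clemens–Griffiths 1972, Lemma 3.20 (ii)
# and the uniqueness in Cor. 3.23)

Layer `Literature/Geometry/Kaehler`, namespace `Literature.Geometry.Kaehler.ComplexTorus`; lane `lit-hodgefound`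
(Track 2 foundations library), skeleton seat `lit-hodgefound-skel-2` (generation 35), plan row A2-127 — sequel
of A2-126 (`ComplexTorusThetaDivisorComponentsProductFamily`: for `(X, η)` principally polarised and a
hypersurface `Θ` of class `c₁(H)` with irreducible components `C` and Néron–Severi forms `η_C`, the
subspaces `U_C = Λ(η − η_C)⁰` form a product family of `(X, η)` with principally polarised factors
`B_C`; `(U_C, W_C) = (Λ(η − η_C)⁰, Λ(η_C)⁰)` is a product pair). THEOREMS ONLY (no definition, no named
fact, net debt `0`).

## Source, VERBATIM

C. H. Clemens, P. A. Griffiths, *The intermediate Jacobian of the cubic threefold*, Ann. of Math. **95**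
(1972), §3 p. 297 (held `paper:doi-10-2307-1970801`, p0017 L45 – p0018 L59): "**LEMMA 3.20.** […]
there exist principally polarized abelian varieties `𝒯ᵢ = (Wᵢ, Uᵢ, ℋᵢ)` such that: (i)
`𝒯 ≅ 𝒯₁ ⊕ ⋯ ⊕ 𝒯_n`, (ii) under the isomorphism (i), `Θᵢ` corresponds to
`(W₁/U₁) × ⋯ × (Wᵢ₋₁/Uᵢ₋₁) × Θ(𝒯ᵢ) × (Wᵢ₊₁/Uᵢ₊₁) × ⋯ × (W_n/U_n)`. […] **Definition 3.22.** A principally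
polarized complex torus `𝒯` is irreducible if for any morphism `φ : 𝒯′ → 𝒯` either `𝒯′ = 0` or `φ` is an
isomorphism. Since the direct summands of `𝒯` in Lemma 3.20 were constructed intrinsically from the
components of `Θ(𝒯)`, we have: **COROLLARY 3.23.** If `𝒯` is a principally polarized abelian variety, `𝒯`
has a unique decomposition into the direct sum of irreducible principally polarized abelian varieties.
`𝒯` itself is irreducible if and only if `Θ(𝒯)` is irreducible."

## What this file proves (the tree's carriers; `U_C`, `W_C` as in A2-126)

For `(X = E/Φ(ℤ^ι), η)` principally polarised (inner-product model, positively oriented `e`), `Θ` a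
closed analytic hypersurface with `[Θ]_e = ofRealForm (−η)` (every theta divisor, A2-121), `C` an
irreducible component with Néron–Severi form `η₀` (`[C]_e = ofRealForm (−η₀)`):

* §1 **(ii) — `Θ_C` is a cylinder over `K_C = π(Φ(Λ(η_C)⁰ ⊗ ℝ))`**: `cover_add_mem_component_iff`
  (`C + K_C = C`, Swinnerton-Dyer's Thm. 23 via A2-116), **`IsPrincipalPolarization.eq_inter_add_image_component`**:
  `C = (C ∩ π(ΦU_C)) + π(ΦW_C)` — "`Θᵢ` corresponds to `B₁ × ⋯ × Θ(𝒯ᵢ) × ⋯ × B_n`" internally —, with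
  `IsPrincipalPolarization.orthSubspace_nsForm_eq_orthSubspace_component` (`W_C = U_C^{⊥η}`) and
  **`IsPrincipalPolarization.orthSubspace_nsForm_eq_iSup_ne`** (`W_C = ⨆_{C′≠C} U_{C′}`: `K_C` is the
  product of the other factors).
* §2 **`Θ(𝒯_C)`, the theta divisor of the factor.** The restriction `ϑ₀|_{ΦU_C}` of a theta function of
  `𝒪_X(C)` (type `(η₀, χ₀)`, zero set `π⁻¹C`) is a canonical theta function `≢ 0` of the principal
  polarisation `η|_{U_C}` of `B_C` (`pullbackForm_subtypeL_eq_of_isNSForm_sub`: `η|_{U_C} = η₀|_{U_C}`;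
  `comp_subtypeL_mem_thetaFunctions_of_isNSForm_sub`; `IsPrincipalPolarization.comp_subtypeL_ne_zero_component`),
  and its divisor is `ι_{B_C}⁻¹(C)` (`image_zeroSet_comp_subtypeL_eq_preimage`).
* §3 **`ι_{B_C}⁻¹(C)` is irreducible** (`IsPrincipalPolarization.isIrreducibleAnalyticSet_preimage_subtorus_component`):
  along p16's addition isomorphism `B_C × K_C ⥲ X` the component `C` pulls back to the cylinder
  `ι_{B_C}⁻¹(C) × K_C`, which is irreducible only if its base is.
* §4 **THE FACTORS ARE IRREDUCIBLE p.p.a.v.'s / INDECOMPOSABLE**: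
  `IsPrincipalPolarization.isPolarizedIrreducible_restrict_component` (Def. 3.22 for `(B_C, η|_{B_C})`, by
  A2-123's «`𝒯` irreducible iff `Θ(𝒯)` irreducible» applied to the factor) and
  **`IsPrincipalPolarization.isIndecomposable_orthSubspace_sub_component`** (`IsIndecomposable Φ η U_C`).
* §5 **COR. 3.23's UNIQUENESS, "constructed intrinsically from the components of `Θ(𝒯)`"**:
  **`IsPrincipalPolarization.range_orthSubspace_components_eq_polarizedComponents`** — the set of the
  `U_C` IS p26's set `polarizedComponents Φ η` of indecomposable factors (Debarre / Eichler–Kneser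
  uniqueness, `IsProductFamily.range_eq_polarizedComponents`), `…injective_orthSubspace_components`,
  hence **`…ncard_components_eq_ncard_polarizedComponents`** and **`…ncard_components_le`**
  (`#components(Θ) = #irreducible factors ≤ g = dim X`).
* §6 `IsPrincipalPolarization.range_orthSubspace_components_eq_polarizedComponents_thetaDivisor` — the
  conjunction for the theta divisor `Θ = π({ϑ = 0})` of a canonical theta function.

Not here: the external form of (i)/(ii) on the product torus `∏_C B_C` (`sigmaPiPeriod`) — the internal
product family and p16's binary addition isomorphisms carry the same content.
-- TODO(general form): none beyond A2-126's (non-principal polarisations, Lange Thm. 2.2.1 with `|M|`).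

## References

* [ClemensGriffiths1972] C. H. Clemens, P. A. Griffiths, *The intermediate Jacobian of the cubic
  threefold*, Ann. of Math. 95 (1972), §3 Lemma 3.20, Def. 3.22, Cor. 3.23 (pp. 296–297).
* [Lange2023AbelianVarietiesComplex] H. Lange, *Abelian Varieties over the Complex Numbers* (2023),
  §2.2.1 Thm. 2.2.1, §1.5.4 Lemma 1.5.10, §2.4.4 Cor. 2.4.24 / 2.4.31, §1.3.3 Lemma 1.3.6.
* [Debarre1996PolarisationsProduits] O. Debarre, *Polarisations sur les variétés abéliennes produits*,
  C. R. Acad. Sci. Paris 323 (1996), Corollaire 2.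
* [SwinnertonDyer1974AbelianVarieties] H. P. F. Swinnerton-Dyer, *Analytic Theory of Abelian Varieties*
  (1974), Ch. II §5 Thm. 23.
* [Chirka1989] E. M. Chirka, *Complex Analytic Sets* (1989), §5.3–§5.4.
-/

noncomputable section

open scoped Manifold Topology ComplexOrder Matrix Pointwise
open Set Filter Function Module TopologicalSpace Complex
open Literature.Algebra.EuclideanLattices

namespace Literature.Geometry.Kaehler

universe u

namespace ComplexTorus

variable {ι : Type*} [Fintype ι] [DecidableEq ι] {E : Type u} [NormedAddCommGroup E]
  [InnerProductSpace ℂ E] [FiniteDimensional ℂ E] [MeasurableSpace E] [BorelSpace E]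
  (Φ : (ι → ℝ) ≃L[ℝ] E) {g q : ℕ} (e : Fin (2 * g) ≃ ι) (hq : 2 * q + 2 = 2 * g)
  {η : E [⋀^Fin 2]→L[ℝ] ℝ} {Θ : Set (ComplexTorus Φ)}

/-! ### §1 `Θ_C` is a cylinder over `K_C`: `C + K_C = C` and `C = (C ∩ B_C) + K_C` -/

section Cylinder

include hq in
/-- **`C + K_C = C`: a component is invariant under the radical torus of its own Néron–Severi form**
(Swinnerton-Dyer's Thm. 23 "a degenerate divisor is a pull-back", A2-116, read for ANY form `η₀` with
`[C]_e = ofRealForm (−η₀)` by uniqueness of that form): `π(v + r) ∈ C ↔ π(v) ∈ C` for `r ∈ Φ(Λ(η₀)⁰ ⊗ ℝ)`.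
[cite: SwinnertonDyer1974AbelianVarieties, Ch. II §5 Thm. 23] [cite: ClemensGriffiths1972, §3 proof of Lemma 3.20 («a + Θⱼ = Θⱼ»), p. 297] -/
theorem cover_add_mem_component_iff (he : orientationSign Φ e = 1) {C : Set (ComplexTorus Φ)}
    (hCd : HasPureDim 𝓘(ℂ, E) C q) {η₀ : E [⋀^Fin 2]→L[ℝ] ℝ}
    (hcl₀ : analyticCycleClass Φ e hq hCd = ofRealForm (-η₀)) {r : E}
    (hr : r ∈ cxSpan Φ (orthSubspace Φ η₀ ⊤)) (v : E) : cover Φ (v + r) ∈ C ↔ cover Φ v ∈ C := by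
  obtain ⟨η', -, hcl', hinv⟩ := cover_add_mem_iff_of_hasPureDim Φ e hq hCd he
  have : η' = η₀ := neg_injective (ofRealForm_injective (hcl'.symm.trans hcl₀))
  subst this
  exact hinv r hr v

omit [Fintype ι] [DecidableEq ι] [FiniteDimensional ℂ E] [MeasurableSpace E] [BorelSpace E] in
/-- Every vector splits along complementary subspaces: `v = Φu + Φw` with `u ∈ U`, `w ∈ W`. [folklore] -/
private theorem exists_add_eq_of_isCompl {U W : Submodule ℝ (ι → ℝ)} (hc : IsCompl U W) (v : E) :
    ∃ u ∈ U, ∃ w ∈ W, v = Φ u + Φ w := by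
  have hv : Φ.symm v ∈ U ⊔ W := by rw [hc.sup_eq_top]; exact Submodule.mem_top
  obtain ⟨u, hu, w, hw, huw⟩ := Submodule.mem_sup.1 hv
  refine ⟨u, hu, w, hw, ?_⟩
  rw [← map_add, huw, ContinuousLinearEquiv.apply_symm_apply]

include hq in
/-- **LEMMA 3.20 (ii), INTERNALLY: `Θ_C = (Θ_C ∩ B_C) + K_C`** — the component `C` is the sum, in the group
`X`, of its trace on the subtorus `π(ΦU_C)` of the factor `B_C` and the complementary subtorus
`K_C = π(ΦW_C)` ("`Θᵢ` corresponds to `(W₁/U₁) × ⋯ × Θ(𝒯ᵢ) × ⋯ × (W_n/U_n)`": `K_C` is the product of the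
other factors, `orthSubspace_nsForm_eq_iSup_ne`). [cite: ClemensGriffiths1972, §3 Lemma 3.20 (ii), p. 296] -/
theorem IsPrincipalPolarization.eq_inter_add_image_component (hP : IsPrincipalPolarization Φ η)
    (he : orientationSign Φ e = 1) (hΘ : HasPureDim 𝓘(ℂ, E) Θ q)
    (hcl : analyticCycleClass Φ e hq hΘ = ofRealForm (-η)) {C : Set (ComplexTorus Φ)}
    (hC : IsIrreducibleComponent 𝓘(ℂ, E) Θ C) {η₀ : E [⋀^Fin 2]→L[ℝ] ℝ} (hη₀ : IsNSForm Φ η₀)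
    (hcl₀ : analyticCycleClass Φ e hq (hC.hasPureDim hΘ) = ofRealForm (-η₀)) :
    C = (C ∩ cover Φ '' (cxSpan Φ (orthSubspace Φ (η - η₀) ⊤) : Set E)) +
      cover Φ '' (cxSpan Φ (orthSubspace Φ η₀ ⊤) : Set E) := by
  have hpair := (hP.isProductPair_nsRadical_component Φ e hq he hΘ hcl hC hη₀ hcl₀).2.2.2.2
  have hinv := fun r (hr : r ∈ cxSpan Φ (orthSubspace Φ η₀ ⊤)) v ↦
    cover_add_mem_component_iff Φ e hq he (hC.hasPureDim hΘ) hcl₀ hr v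
  refine Subset.antisymm (fun x hx ↦ ?_) ?_
  · obtain ⟨v, rfl⟩ := cover_surjective Φ x
    obtain ⟨u, hu, w, hw, hv⟩ := exists_add_eq_of_isCompl Φ hpair.isCompl v
    have hw' : Φ w ∈ cxSpan Φ (orthSubspace Φ η₀ ⊤) := apply_mem_cxSpan Φ _ hw
    refine ⟨cover Φ (Φ u), ⟨?_, Φ u, apply_mem_cxSpan Φ _ hu, rfl⟩, cover Φ (Φ w), ⟨Φ w, hw', rfl⟩, ?_⟩
    · rw [← hinv (Φ w) hw' (Φ u), ← hv]; exact hx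
    · change cover Φ (Φ u) + cover Φ (Φ w) = cover Φ v
      rw [← cover_add, ← hv]
  · rintro _ ⟨y, ⟨hyC, -⟩, z, ⟨r, hr, rfl⟩, rfl⟩
    obtain ⟨v, rfl⟩ := cover_surjective Φ y
    change cover Φ v + cover Φ r ∈ C
    rw [← cover_add]
    exact (hinv r hr v).2 hyC

include hq in
/-- **`W_C = U_C^{⊥η}`**: the complementary space `Λ(η_C)⁰` is the `η`-orthogonal of `U_C = Λ(η − η_C)⁰`
(the right member of a product pair of a p.p.a.v. is determined by the left one).
[cite: Lange2023AbelianVarietiesComplex, §2.4.4 Cor. 2.4.31, p. 125] [cite: ClemensGriffiths1972, §3 (3.6), p. 293] -/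
theorem IsPrincipalPolarization.orthSubspace_nsForm_eq_orthSubspace_component (hP : IsPrincipalPolarization Φ η)
    (he : orientationSign Φ e = 1) (hΘ : HasPureDim 𝓘(ℂ, E) Θ q)
    (hcl : analyticCycleClass Φ e hq hΘ = ofRealForm (-η)) {C : Set (ComplexTorus Φ)}
    (hC : IsIrreducibleComponent 𝓘(ℂ, E) Θ C) {η₀ : E [⋀^Fin 2]→L[ℝ] ℝ} (hη₀ : IsNSForm Φ η₀)
    (hcl₀ : analyticCycleClass Φ e hq (hC.hasPureDim hΘ) = ofRealForm (-η₀)) :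
    orthSubspace Φ η₀ ⊤ = orthSubspace Φ η (orthSubspace Φ (η - η₀) ⊤) :=
  (hP.isProductPair_nsRadical_component Φ e hq he hΘ hcl hC hη₀ hcl₀).2.2.2.2.right_eq_orthSubspace Φ
    hP.isRiemannForm

include hq in
/-- **`K_C` is the product of the other factors: `W_C = Λ(η_C)⁰ = ⨆_{C′ ≠ C} U_{C′}`** (both are the
`η`-orthogonal complement of `U_C` in the product family of A2-126; "`(W₁/U₁) × ⋯ × \widehat{𝒯ᵢ} × ⋯ × (W_n/U_n)`").
[cite: ClemensGriffiths1972, §3 Lemma 3.20 (ii), p. 296] [cite: Debarre1996PolarisationsProduits, Corollaire 2 a)] -/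
theorem IsPrincipalPolarization.orthSubspace_nsForm_eq_iSup_ne (hP : IsPrincipalPolarization Φ η)
    (he : orientationSign Φ e = 1) (hΘ : HasPureDim 𝓘(ℂ, E) Θ q)
    (hcl : analyticCycleClass Φ e hq hΘ = ofRealForm (-η))
    (ηC : {C : Set (ComplexTorus Φ) // IsIrreducibleComponent 𝓘(ℂ, E) Θ C} → E [⋀^Fin 2]→L[ℝ] ℝ)
    (hηC : ∀ C, IsNSForm Φ (ηC C) ∧ analyticCycleClass Φ e hq (C.2.hasPureDim hΘ) = ofRealForm (-ηC C))
    (C : {C : Set (ComplexTorus Φ) // IsIrreducibleComponent 𝓘(ℂ, E) Θ C}) :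
    orthSubspace Φ (ηC C) ⊤ =
      ⨆ (C' : {C : Set (ComplexTorus Φ) // IsIrreducibleComponent 𝓘(ℂ, E) Θ C}) (_ : C' ≠ C),
        orthSubspace Φ (η - ηC C') ⊤ := by
  have hη := hP.isRiemannForm
  have hF := hP.isProductFamily_orthSubspace_components Φ e hq he hΘ hcl ηC hηC
  rw [hP.orthSubspace_nsForm_eq_orthSubspace_component Φ e hq he hΘ hcl C.2 (hηC C).1 (hηC C).2]
  exact ((hF.isProductPair_iSup_ne Φ hη C).right_eq_orthSubspace Φ hη).symm

end Cylinder

/-! ### §2 `Θ(𝒯_C)`: the restriction of a theta function of `𝒪_X(C)` to the factor `B_C` -/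

section Restrict

omit [Fintype ι] [DecidableEq ι] [FiniteDimensional ℂ E] [MeasurableSpace E] [BorelSpace E] in
/-- **`η|_{U_C} = η_C|_{U_C}`**: on `Φ(U_C) = Φ(Λ(η − η_C)⁰ ⊗ ℝ)` the polarisation `η` and the Néron–Severi
form `η_C` of the component agree (`η − η_C` vanishes against `U_C`). [cite: ClemensGriffiths1972, §3 proof of Lemma 3.20 («Θ induces a principal polarization on Bᵢ»), p. 297] -/
theorem pullbackForm_subtypeL_eq_of_isNSForm_sub {η₀ : E [⋀^Fin 2]→L[ℝ] ℝ} (hNS : IsNSForm Φ (η - η₀)) :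
    pullbackForm (cxSpan Φ (orthSubspace Φ (η - η₀) ⊤)).subtypeL η =
      pullbackForm (cxSpan Φ (orthSubspace Φ (η - η₀) ⊤)).subtypeL η₀ := by
  have hUc := isComplexSubspace_orthSubspace_top Φ (η - η₀) hNS.type_one_one
  ext x
  have hx : x = ![x 0, x 1] := by funext i; fin_cases i <;> rfl
  rw [hx, pullbackForm_apply, pullbackForm_apply]
  have h0 : (η - η₀) ![((cxSpan Φ (orthSubspace Φ (η - η₀) ⊤)).subtypeL (x 0) : E),
      ((cxSpan Φ (orthSubspace Φ (η - η₀) ⊤)).subtypeL (x 1) : E)] = 0 := by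
    have hmem := (mem_cxSpan_iff hUc).1 (x 0).2
    have := (mem_orthSubspace_top_iff Φ (η - η₀)).1 hmem ((x 1 : cxSpan Φ (orthSubspace Φ (η - η₀) ⊤)) : E)
    rwa [ContinuousLinearEquiv.apply_symm_apply] at this
  rw [ContinuousAlternatingMap.sub_apply, sub_eq_zero] at h0
  exact h0

variable {C : Set (ComplexTorus Φ)} {η₀ : E [⋀^Fin 2]→L[ℝ] ℝ} {χ₀ : (ι → ℤ) → ℂ} {ϑ₀ : E → ℂ}

omit [DecidableEq ι] [FiniteDimensional ℂ E] [MeasurableSpace E] [BorelSpace E] in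
/-- **The restriction `ϑ₀|_{Φ(U_C)}` is a canonical theta function of the factor `(B_C, η|_{B_C})`** for the
pulled-back semicharacter `χ₀ ∘ C_{U_C}` (Lange's Lemma 1.3.6 `ι^*L(H, χ) = L(ι^*H, χ ∘ ρ_r(ι))` for the
inclusion `ι : B_C ↪ X`, p04's `comp_mem_thetaFunctions` / `canonicalFactor_pullback`, and §2's
`η|_{U_C} = η_C|_{U_C}`). [cite: Lange2023AbelianVarietiesComplex, §1.3.3 Lemma 1.3.6] [cite: ClemensGriffiths1972, §3 Lemma 3.20 (ii), p. 296] -/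
theorem comp_subtypeL_mem_thetaFunctions_of_isNSForm_sub (hNS : IsNSForm Φ (η - η₀))
    (hχ₀ : IsSemicharacter Φ η₀ χ₀) (hϑ₀ : ϑ₀ ∈ thetaFunctions Φ (canonicalFactor Φ η₀ χ₀))
    (hU : IsLatticeSubspace (orthSubspace Φ (η - η₀) ⊤)) (hUc : IsComplexSubspace Φ (orthSubspace Φ (η - η₀) ⊤)) :
    IsSemicharacter (subtorusPeriod Φ (orthSubspace Φ (η - η₀) ⊤) hU hUc)
        (pullbackForm (cxSpan Φ (orthSubspace Φ (η - η₀) ⊤)).subtypeL η)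
        (fun m ↦ χ₀ ((subtorusMatrix (orthSubspace Φ (η - η₀) ⊤)).mulVec m)) ∧
      (fun y : cxSpan Φ (orthSubspace Φ (η - η₀) ⊤) ↦ ϑ₀ (y : E)) ∈
        thetaFunctions (subtorusPeriod Φ (orthSubspace Φ (η - η₀) ⊤) hU hUc)
          (canonicalFactor (subtorusPeriod Φ (orthSubspace Φ (η - η₀) ⊤) hU hUc)
            (pullbackForm (cxSpan Φ (orthSubspace Φ (η - η₀) ⊤)).subtypeL η)
            (fun m ↦ χ₀ ((subtorusMatrix (orthSubspace Φ (η - η₀) ⊤)).mulVec m))) := by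
  set U := orthSubspace Φ (η - η₀) ⊤ with hUdef
  have hF := apply_mulVec_subtorusMatrix Φ U hU hUc
  rw [pullbackForm_subtypeL_eq_of_isNSForm_sub Φ hNS]
  refine ⟨hχ₀.pullback (subtorusPeriod Φ U hU hUc) Φ (F := (cxSpan Φ U).subtypeL) hF, ?_⟩
  have h1 := comp_mem_thetaFunctions (subtorusPeriod Φ U hU hUc) Φ (F := (cxSpan Φ U).subtypeL) hF hϑ₀
  have hfac : (fun n (w : cxSpan Φ U) ↦ canonicalFactor Φ η₀ χ₀ ((subtorusMatrix U).mulVec n)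
      ((cxSpan Φ U).subtypeL w)) =
      canonicalFactor (subtorusPeriod Φ U hU hUc) (pullbackForm (cxSpan Φ U).subtypeL η₀)
        (fun m ↦ χ₀ ((subtorusMatrix U).mulVec m)) := by
    funext n w
    exact (canonicalFactor_pullback (subtorusPeriod Φ U hU hUc) Φ (F := (cxSpan Φ U).subtypeL) hF η₀ χ₀ n w).symm
  rw [hfac] at h1
  exact h1

include hq in
/-- **`ϑ₀|_{Φ(U_C)} ≢ 0`**: otherwise `Φ(U_C) ⊆ π⁻¹C`, and since `π⁻¹C` is invariant under `Φ(W_C)` and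
`E = Φ(U_C) + Φ(W_C)`, the hypersurface `C` would be all of `X`.
[cite: ClemensGriffiths1972, §3 proof of Lemma 3.20, p. 297] [cite: Chirka1989, §2.1 (a proper analytic subset has empty interior)] -/
theorem IsPrincipalPolarization.comp_subtypeL_ne_zero_component (hP : IsPrincipalPolarization Φ η)
    (he : orientationSign Φ e = 1) (hΘ : HasPureDim 𝓘(ℂ, E) Θ q)
    (hcl : analyticCycleClass Φ e hq hΘ = ofRealForm (-η)) (hC : IsIrreducibleComponent 𝓘(ℂ, E) Θ C)
    (hη₀ : IsNSForm Φ η₀) (hcl₀ : analyticCycleClass Φ e hq (hC.hasPureDim hΘ) = ofRealForm (-η₀))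
    (hzero₀ : {w | ϑ₀ w = 0} = cover Φ ⁻¹' C) :
    (fun y : cxSpan Φ (orthSubspace Φ (η - η₀) ⊤) ↦ ϑ₀ (y : E)) ≠ 0 := by
  have hCd : HasPureDim 𝓘(ℂ, E) C q := hC.hasPureDim hΘ
  have hdim : finrank ℂ E = q + 1 := finrank_eq_succ_of_rank Φ e hq
  have hCc : HasPureCodim 𝓘(ℂ, E) C 1 := by
    have := hCd.hasPureCodim
    rwa [hdim, show q + 1 - q = 1 by omega] at this
  have hpair := (hP.isProductPair_nsRadical_component Φ e hq he hΘ hcl hC hη₀ hcl₀).2.2.2.2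
  intro h0
  have hall : cover Φ ⁻¹' C = univ := by
    refine eq_univ_of_forall fun v ↦ ?_
    obtain ⟨u, hu, w, hw, hv⟩ := exists_add_eq_of_isCompl Φ hpair.isCompl v
    have hu' : Φ u ∈ cover Φ ⁻¹' C := by
      rw [← hzero₀]
      exact congr_fun h0 ⟨Φ u, apply_mem_cxSpan Φ _ hu⟩
    rw [hv]
    exact (cover_add_mem_component_iff Φ e hq he hCd hcl₀ (apply_mem_cxSpan Φ _ hw) (Φ u)).2 hu'
  have hint := SCV.interior_eq_empty_of_hasPureCodim (hasPureCodim_cover_preimage (Φ := Φ) hCc)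
  rw [hall, interior_univ] at hint
  exact univ_nonempty.ne_empty hint

omit [DecidableEq ι] [FiniteDimensional ℂ E] [MeasurableSpace E] [BorelSpace E] in
/-- **The divisor of `ϑ₀|_{Φ(U_C)}` on the factor is `ι_{B_C}⁻¹(C)`**: `π_{B_C}({ϑ₀|_{Φ(U_C)} = 0}) = ι⁻¹(C)`
for the inclusion `ι = ρ(C_{U_C}) : B_C ↪ X` ("`Θ(𝒯ᵢ)`"). [cite: ClemensGriffiths1972, §3 Lemma 3.20 (ii), p. 296] -/
theorem image_zeroSet_comp_subtypeL_eq_preimage (hzero₀ : {w | ϑ₀ w = 0} = cover Φ ⁻¹' C)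
    {U : Submodule ℝ (ι → ℝ)} (hU : IsLatticeSubspace U) (hUc : IsComplexSubspace Φ U)
    {e₁ : (Fin (subRank U) → ℤ) → cxSpan Φ U → ℂ} (he₁ : IsFactor (subtorusPeriod Φ U hU hUc) e₁)
    (hϑ₁ : (fun y : cxSpan Φ U ↦ ϑ₀ (y : E)) ∈ thetaFunctions (subtorusPeriod Φ U hU hUc) e₁) :
    cover (subtorusPeriod Φ U hU hUc) '' {y | ϑ₀ (y : E) = 0} =
      mapMatrix (subtorusPeriod Φ U hU hUc) Φ (subtorusMatrix U) ⁻¹' C := by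
  have hF := apply_mulVec_subtorusMatrix Φ U hU hUc
  have hsat := cover_preimage_image_zeroSet he₁ hϑ₁
  ext t
  obtain ⟨y, rfl⟩ := cover_surjective (subtorusPeriod Φ U hU hUc) t
  have h1 : cover (subtorusPeriod Φ U hU hUc) y ∈ cover (subtorusPeriod Φ U hU hUc) '' {y | ϑ₀ (y : E) = 0} ↔
      ϑ₀ (y : E) = 0 := by
    change y ∈ cover (subtorusPeriod Φ U hU hUc) ⁻¹' (cover (subtorusPeriod Φ U hU hUc) ''
      ((fun y : cxSpan Φ U ↦ ϑ₀ (y : E)) ⁻¹' {0})) ↔ _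
    rw [hsat]
    rfl
  have h2 : cover (subtorusPeriod Φ U hU hUc) y ∈ mapMatrix (subtorusPeriod Φ U hU hUc) Φ (subtorusMatrix U) ⁻¹' C ↔
      ϑ₀ (y : E) = 0 := by
    rw [mem_preimage, ← cover_apply_eq_mapMatrix_cover hF y, Submodule.subtypeL_apply,
      show (cover Φ (y : E) ∈ C) = ((y : E) ∈ cover Φ ⁻¹' C) from rfl, ← hzero₀]
    rfl
  rw [h1, h2]

end Restrict

/-! ### §3 `ι_{B_C}⁻¹(C)` is irreducible: `C` is the cylinder `ι⁻¹(C) × K_C` along `B_C × K_C ⥲ X` -/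

section Irreducible

variable {C : Set (ComplexTorus Φ)} {η₀ : E [⋀^Fin 2]→L[ℝ] ℝ}

include hq in
/-- **`ι_{B_C}⁻¹(Θ_C)` IS AN IRREDUCIBLE ANALYTIC SUBSET OF THE FACTOR `B_C`.** Along p16's addition
isomorphism `μ : B_C × K_C ⥲ X` of the product pair `(U_C, W_C)` the irreducible component `C` pulls back to
`μ⁻¹(C) = ι⁻¹(C) × K_C` (`C + K_C = C`), an irreducible analytic subset of the product torus; a covering
`ι⁻¹(C) ⊆ A ∪ B` by analytic sets gives the covering `μ⁻¹(C) ⊆ (A × K_C) ∪ (B × K_C)`, so `ι⁻¹(C)` lies in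
`A` or in `B`. [cite: ClemensGriffiths1972, §3 Lemma 3.20 (ii), p. 296] [cite: Chirka1989, §5.3 (irreducibility under biholomorphic maps) and §2.1 item 4] -/
theorem IsPrincipalPolarization.isIrreducibleAnalyticSet_preimage_subtorus_component
    (hP : IsPrincipalPolarization Φ η) (he : orientationSign Φ e = 1) (hΘ : HasPureDim 𝓘(ℂ, E) Θ q)
    (hcl : analyticCycleClass Φ e hq hΘ = ofRealForm (-η)) (hC : IsIrreducibleComponent 𝓘(ℂ, E) Θ C)
    (hη₀ : IsNSForm Φ η₀) (hcl₀ : analyticCycleClass Φ e hq (hC.hasPureDim hΘ) = ofRealForm (-η₀))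
    (hU : IsLatticeSubspace (orthSubspace Φ (η - η₀) ⊤)) (hUc : IsComplexSubspace Φ (orthSubspace Φ (η - η₀) ⊤)) :
    IsIrreducibleAnalyticSet 𝓘(ℂ, ↥(cxSpan Φ (orthSubspace Φ (η - η₀) ⊤)))
      (mapMatrix (subtorusPeriod Φ (orthSubspace Φ (η - η₀) ⊤) hU hUc) Φ
        (subtorusMatrix (orthSubspace Φ (η - η₀) ⊤)) ⁻¹' C) := by
  have hpair := (hP.isProductPair_nsRadical_component Φ e hq he hΘ hcl hC hη₀ hcl₀).2.2.2.2
  set U := orthSubspace Φ (η - η₀) ⊤ with hUdef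
  set W := orthSubspace Φ η₀ ⊤ with hWdef
  have hW : IsLatticeSubspace W := hpair.isLatticeSubspace_right
  have hWc : IsComplexSubspace Φ W := hpair.isComplexSubspace_right
  set Φ₁ := subtorusPeriod Φ U hU hUc with hΦ₁
  set Φ₂ := subtorusPeriod Φ W hW hWc with hΦ₂
  have hinv := fun r (hr : r ∈ cxSpan Φ W) v ↦
    cover_add_mem_component_iff Φ e hq he (hC.hasPureDim hΘ) hcl₀ hr v
  -- the inclusion `ι : B_C → X` and `D = ι⁻¹(C)`
  have hF := apply_mulVec_subtorusMatrix Φ U hU hUc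
  set D := mapMatrix Φ₁ Φ (subtorusMatrix U) ⁻¹' C with hD
  have hιU : ∀ y : cxSpan Φ U, mapMatrix Φ₁ Φ (subtorusMatrix U) (cover Φ₁ y) = cover Φ (y : E) := fun y ↦
    (cover_apply_eq_mapMatrix_cover hF y).symm
  -- the addition isomorphism `μ : B_C × K_C ⥲ X`
  obtain ⟨hadd, hiso, hhA⟩ := hpair.exists_isPolarizedIso_addition
  have hCadd : ∀ x, Φ ((additionMatrix U W).map (Int.cast : ℤ → ℝ) *ᵥ x) =
      additionRep Φ U W (prodPeriod Φ₁ Φ₂ x) := additionRep_prodPeriod Φ hU hUc hW hWc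
  have hcov : ∀ x : cxSpan Φ U × cxSpan Φ W,
      hadd (cover (prodPeriod Φ₁ Φ₂) x) = cover Φ ((x.1 : E) + (x.2 : E)) := fun x ↦ by
    rw [hhA, ← cover_apply_eq_mapMatrix_cover hCadd x, additionRep_apply]
  -- `μ⁻¹(C) = D × K_C`
  have hset : hadd ⁻¹' C = prodHomeomorph Φ₁ Φ₂ ⁻¹' (D ×ˢ univ) := by
    ext t
    obtain ⟨x, rfl⟩ := cover_surjective (prodPeriod Φ₁ Φ₂) t
    rw [mem_preimage, hcov, mem_preimage, prodHomeomorph_cover, mem_prod]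
    simp only [mem_univ, and_true]
    rw [hD, mem_preimage, hιU, hinv _ x.2.2]
  -- `μ⁻¹(C)` is irreducible
  let hh : ComplexTorus (prodPeriod Φ₁ Φ₂) ≃ₜ ComplexTorus Φ :=
    { toEquiv := hadd.toEquiv
      continuous_toFun := hiso.1.continuous
      continuous_invFun := hiso.2.1.continuous }
  have hirr' := IsIrreducibleAnalyticSet.preimage_homeomorph' (I := 𝓘(ℂ, cxSpan Φ U × cxSpan Φ W))
    (I' := 𝓘(ℂ, E)) hh (hiso.1.mdifferentiable (by simp)) (hiso.2.1.mdifferentiable (by simp))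
    hC.isIrreducibleAnalyticSet
  have hpre : (hh : ComplexTorus (prodPeriod Φ₁ Φ₂) → ComplexTorus Φ) ⁻¹' C = hadd ⁻¹' C := rfl
  rw [hpre, hset] at hirr'
  -- conclude for `D`
  have hιdiff : MDifferentiable 𝓘(ℂ, ↥(cxSpan Φ U)) 𝓘(ℂ, E) (mapMatrix Φ₁ Φ (subtorusMatrix U)) :=
    (contMDiff_mapMatrix (n := ⊤) (cxSpan Φ U).subtypeL hF).mdifferentiable (by simp)
  refine ⟨hC.isIrreducibleAnalyticSet.1.preimage hιdiff, ?_, fun A B hA hB hDAB ↦ ?_⟩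
  · obtain ⟨t, ht⟩ := hirr'.2.1
    exact ⟨(prodHomeomorph Φ₁ Φ₂ t).1, (mem_prod.1 ht).1⟩
  · have hsub : prodHomeomorph Φ₁ Φ₂ ⁻¹' (D ×ˢ univ) ⊆
        prodHomeomorph Φ₁ Φ₂ ⁻¹' (A ×ˢ univ) ∪ prodHomeomorph Φ₁ Φ₂ ⁻¹' (B ×ˢ univ) := by
      intro t ht
      simp only [mem_preimage, mem_prod, mem_univ, and_true, mem_union] at ht ⊢
      exact hDAB ht
    have key : ∀ {A' : Set (ComplexTorus Φ₁)}, prodHomeomorph Φ₁ Φ₂ ⁻¹' (D ×ˢ univ) ⊆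
        prodHomeomorph Φ₁ Φ₂ ⁻¹' (A' ×ˢ univ) → D ⊆ A' := by
      intro A' h d hd
      have hmem : (prodHomeomorph Φ₁ Φ₂).symm (d, 0) ∈ prodHomeomorph Φ₁ Φ₂ ⁻¹' (D ×ˢ univ) := by
        rw [mem_preimage, Homeomorph.apply_symm_apply]
        exact ⟨hd, mem_univ _⟩
      have := h hmem
      rw [mem_preimage, Homeomorph.apply_symm_apply] at this
      exact this.1
    rcases hirr'.2.2 _ _ (isAnalyticSet_preimage_prodHomeomorph_prod Φ₁ Φ₂ hA isAnalyticSet_univ)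
      (isAnalyticSet_preimage_prodHomeomorph_prod Φ₁ Φ₂ hB isAnalyticSet_univ) hsub with h | h
    · exact Or.inl (key h)
    · exact Or.inr (key h)

end Irreducible

/-! ### §4 The factors `(B_C, η|_{B_C})` are irreducible p.p.a.v.'s: `U_C` is indecomposable -/

section Indecomposable

variable {C : Set (ComplexTorus Φ)} {η₀ : E [⋀^Fin 2]→L[ℝ] ℝ}

include hq in
/-- **THE FACTOR `𝒯_C = (B_C, η|_{B_C})` IS AN IRREDUCIBLE p.p.a.v. (Definition 3.22).** Its theta divisor
`Θ(𝒯_C) = ι⁻¹(Θ_C)` (§2) is irreducible (§3), so A2-123's «`𝒯` is irreducible iff `Θ(𝒯)` is irreducible»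
applies to the factor. [cite: ClemensGriffiths1972, §3 Lemma 3.20, Def. 3.22, Cor. 3.23, pp. 296–297] -/
theorem IsPrincipalPolarization.isPolarizedIrreducible_restrict_component (hP : IsPrincipalPolarization Φ η)
    (he : orientationSign Φ e = 1) (hΘ : HasPureDim 𝓘(ℂ, E) Θ q)
    (hcl : analyticCycleClass Φ e hq hΘ = ofRealForm (-η)) (hC : IsIrreducibleComponent 𝓘(ℂ, E) Θ C)
    (hη₀ : IsNSForm Φ η₀) (hcl₀ : analyticCycleClass Φ e hq (hC.hasPureDim hΘ) = ofRealForm (-η₀))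
    (hU : IsLatticeSubspace (orthSubspace Φ (η - η₀) ⊤)) (hUc : IsComplexSubspace Φ (orthSubspace Φ (η - η₀) ⊤)) :
    IsPolarizedIrreducible (subtorusPeriod Φ (orthSubspace Φ (η - η₀) ⊤) hU hUc)
      (pullbackForm (cxSpan Φ (orthSubspace Φ (η - η₀) ⊤)).subtypeL η) := by
  have core := hP.isProductPair_nsRadical_component Φ e hq he hΘ hcl hC hη₀ hcl₀
  have hNS : IsNSForm Φ (η - η₀) := core.1
  have hpair := core.2.2.2.2
  set U := orthSubspace Φ (η - η₀) ⊤ with hUdef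
  -- the factor is principally polarised and of positive dimension
  obtain ⟨_, _, hP₁, -⟩ := (hP.isProductPair_iff_isPrincipalPolarization_restrict Φ).1 hpair
  have hU0 : U ≠ ⊥ := hP.orthSubspace_sub_ne_bot_component Φ e hq he hΘ hcl hC hη₀ hcl₀
  haveI : Nontrivial (cxSpan Φ U) := Module.nontrivial_of_finrank_pos (finrank_cxSpan_pos Φ hU hUc hU0)
  -- a theta function of `𝒪_X(C)` and its restriction
  obtain ⟨η', χ₀, ϑ₀, -, hχ₀, hϑ₀, -, hzero₀, hcl'⟩ :=
    exists_isNSForm_analyticCycleClass_eq_of_hasPureDim Φ e hq (hC.hasPureDim hΘ) he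
  have hηη : η' = η₀ := neg_injective (ofRealForm_injective (hcl'.symm.trans hcl₀))
  subst hηη
  obtain ⟨hχ₁, hϑ₁⟩ := comp_subtypeL_mem_thetaFunctions_of_isNSForm_sub Φ hNS hχ₀ hϑ₀ hU hUc
  have hϑ₁0 := hP.comp_subtypeL_ne_zero_component Φ e hq he hΘ hcl hC hη₀ hcl₀ (ϑ₀ := ϑ₀) hzero₀
  have hirr := hP.isIrreducibleAnalyticSet_preimage_subtorus_component Φ e hq he hΘ hcl hC hη₀ hcl₀ hU hUc
  rw [← image_zeroSet_comp_subtypeL_eq_preimage Φ hzero₀ hU hUc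
    (isFactor_canonicalFactor _ hP₁.isRiemannForm.isNSForm hχ₁) hϑ₁] at hirr
  exact (hP₁.isPolarizedIrreducible_iff_isIrreducibleAnalyticSet_thetaDivisor _ hχ₁ hϑ₁ hϑ₁0).2 hirr

include hq in
/-- **`U_C` IS INDECOMPOSABLE**: the polarised abelian subvariety `(B_C, η|_{B_C})` on `U_C = Λ(η − η_C)⁰` is
non-zero and admits no product pair inside (p26's `IsIndecomposable`; for a principally polarised factor,
indecomposable ⟺ irreducible in the sense of Def. 3.22).
[cite: ClemensGriffiths1972, §3 Def. 3.22 and Cor. 3.23, p. 297] [cite: Debarre1996PolarisationsProduits, p. 631 («indécomposable»)] -/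
theorem IsPrincipalPolarization.isIndecomposable_orthSubspace_sub_component (hP : IsPrincipalPolarization Φ η)
    (he : orientationSign Φ e = 1) (hΘ : HasPureDim 𝓘(ℂ, E) Θ q)
    (hcl : analyticCycleClass Φ e hq hΘ = ofRealForm (-η)) (hC : IsIrreducibleComponent 𝓘(ℂ, E) Θ C)
    (hη₀ : IsNSForm Φ η₀) (hcl₀ : analyticCycleClass Φ e hq (hC.hasPureDim hΘ) = ofRealForm (-η₀)) :
    IsIndecomposable Φ η (orthSubspace Φ (η - η₀) ⊤) := by
  have core := hP.isProductPair_nsRadical_component Φ e hq he hΘ hcl hC hη₀ hcl₀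
  have hNS : IsNSForm Φ (η - η₀) := core.1
  have hU : IsLatticeSubspace (orthSubspace Φ (η - η₀) ⊤) := isLatticeSubspace_orthSubspace_top Φ (η - η₀) hNS
  have hUc : IsComplexSubspace Φ (orthSubspace Φ (η - η₀) ⊤) :=
    isComplexSubspace_orthSubspace_top Φ (η - η₀) hNS.type_one_one
  obtain ⟨_, _, hP₁, -⟩ := (hP.isProductPair_iff_isPrincipalPolarization_restrict Φ).1 core.2.2.2.2
  exact (isIndecomposable_iff_isPolarizedIrreducible Φ hU hUc hP₁).2
    ⟨hP.orthSubspace_sub_ne_bot_component Φ e hq he hΘ hcl hC hη₀ hcl₀,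
      hP.isPolarizedIrreducible_restrict_component Φ e hq he hΘ hcl hC hη₀ hcl₀ hU hUc⟩

end Indecomposable

/-! ### §5 Cor. 3.23's uniqueness: the components of `Θ` ARE the irreducible factors of `(X, η)` -/

section Bijection

include hq in
/-- **"THE DIRECT SUMMANDS OF `𝒯` WERE CONSTRUCTED INTRINSICALLY FROM THE COMPONENTS OF `Θ(𝒯)`": the set
of the `U_C = Λ(η − η_C)⁰`, `C` running over the irreducible components of `Θ`, IS the set of indecomposable
polarised components of `(X, η)`** (p26's `polarizedComponents Φ η`, the factors of the UNIQUE decomposition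
into irreducible p.p.a.v.'s of Cor. 3.23 / Debarre's Corollaire 2): a product family with indecomposable
members has exactly the polarised components as its members.
[cite: ClemensGriffiths1972, §3 Cor. 3.23, p. 297] [cite: Debarre1996PolarisationsProduits, Corollaire 2 b)] -/
theorem IsPrincipalPolarization.range_orthSubspace_components_eq_polarizedComponents
    (hP : IsPrincipalPolarization Φ η) (he : orientationSign Φ e = 1) (hΘ : HasPureDim 𝓘(ℂ, E) Θ q)
    (hcl : analyticCycleClass Φ e hq hΘ = ofRealForm (-η))
    (ηC : {C : Set (ComplexTorus Φ) // IsIrreducibleComponent 𝓘(ℂ, E) Θ C} → E [⋀^Fin 2]→L[ℝ] ℝ)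
    (hηC : ∀ C, IsNSForm Φ (ηC C) ∧ analyticCycleClass Φ e hq (C.2.hasPureDim hΘ) = ofRealForm (-ηC C)) :
    Set.range (fun C : {C : Set (ComplexTorus Φ) // IsIrreducibleComponent 𝓘(ℂ, E) Θ C} ↦
        orthSubspace Φ (η - ηC C) ⊤) = polarizedComponents Φ η :=
  (hP.isProductFamily_orthSubspace_components Φ e hq he hΘ hcl ηC hηC).range_eq_polarizedComponents
    (fun C ↦ hP.isIndecomposable_orthSubspace_sub_component Φ e hq he hΘ hcl C.2 (hηC C).1 (hηC C).2)
    hP.isRiemannForm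

include hq in
/-- **`C ↦ U_C` is injective** (distinct components give distinct factors).
[cite: ClemensGriffiths1972, §3 Cor. 3.23, p. 297] [cite: Debarre1996PolarisationsProduits, Corollaire 2 b)] -/
theorem IsPrincipalPolarization.injective_orthSubspace_components (hP : IsPrincipalPolarization Φ η)
    (he : orientationSign Φ e = 1) (hΘ : HasPureDim 𝓘(ℂ, E) Θ q)
    (hcl : analyticCycleClass Φ e hq hΘ = ofRealForm (-η))
    (ηC : {C : Set (ComplexTorus Φ) // IsIrreducibleComponent 𝓘(ℂ, E) Θ C} → E [⋀^Fin 2]→L[ℝ] ℝ)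
    (hηC : ∀ C, IsNSForm Φ (ηC C) ∧ analyticCycleClass Φ e hq (C.2.hasPureDim hΘ) = ofRealForm (-ηC C)) :
    Injective (fun C : {C : Set (ComplexTorus Φ) // IsIrreducibleComponent 𝓘(ℂ, E) Θ C} ↦
      orthSubspace Φ (η - ηC C) ⊤) :=
  (hP.isProductFamily_orthSubspace_components Φ e hq he hΘ hcl ηC hηC).injective
    (fun C ↦ hP.isIndecomposable_orthSubspace_sub_component Φ e hq he hΘ hcl C.2 (hηC C).1 (hηC C).2)
    hP.isRiemannForm

include hq in
/-- **THE NUMBER OF IRREDUCIBLE COMPONENTS OF `Θ` EQUALS THE NUMBER OF IRREDUCIBLE FACTORS OF `(X, η)`**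
(the bijection `C ↦ B_C` of Lemma 3.20 / Cor. 3.23). [cite: ClemensGriffiths1972, §3 Lemma 3.20 and Cor. 3.23, pp. 296–297] -/
theorem IsPrincipalPolarization.ncard_components_eq_ncard_polarizedComponents (hP : IsPrincipalPolarization Φ η)
    (he : orientationSign Φ e = 1) (hΘ : HasPureDim 𝓘(ℂ, E) Θ q)
    (hcl : analyticCycleClass Φ e hq hΘ = ofRealForm (-η)) :
    {C : Set (ComplexTorus Φ) | IsIrreducibleComponent 𝓘(ℂ, E) Θ C}.ncard = (polarizedComponents Φ η).ncard := by
  obtain ⟨ηC, hηC⟩ := exists_nsForm_components Φ e hq he hΘ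
  rw [← hP.range_orthSubspace_components_eq_polarizedComponents Φ e hq he hΘ hcl ηC hηC,
    Set.ncard_range_of_injective (hP.injective_orthSubspace_components Φ e hq he hΘ hcl ηC hηC),
    ← Nat.card_coe_set_eq]
  rfl

include hq in
/-- **`#components(Θ) ≤ dim X`**: a p.p.a.v. of dimension `g` has at most `g` irreducible factors (p26:
`2 · #polarizedComponents ≤ rk Λ`). [cite: ClemensGriffiths1972, §3 Lemma 3.20, p. 296] [cite: Debarre1996PolarisationsProduits, Corollaire 2] -/
theorem IsPrincipalPolarization.ncard_components_le (hP : IsPrincipalPolarization Φ η)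
    (he : orientationSign Φ e = 1) (hΘ : HasPureDim 𝓘(ℂ, E) Θ q)
    (hcl : analyticCycleClass Φ e hq hΘ = ofRealForm (-η)) :
    {C : Set (ComplexTorus Φ) | IsIrreducibleComponent 𝓘(ℂ, E) Θ C}.ncard ≤ g := by
  have h1 := hP.isRiemannForm.two_mul_ncard_polarizedComponents_le_card
  rw [← hP.ncard_components_eq_ncard_polarizedComponents Φ e hq he hΘ hcl, ← Fintype.card_congr e,
    Fintype.card_fin] at h1
  omega

end Bijection

/-! ### §6 The theta divisor `Θ(𝒯) = π({ϑ = 0})` of a canonical theta function -/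

section ThetaDivisor

variable {χ : (ι → ℤ) → ℂ} {ϑ : E → ℂ}

include hq in
/-- **LEMMA 3.20 / COR. 3.23 FOR `Θ(𝒯)`: the factors cut out by the irreducible components of the theta
divisor of a p.p.a.v. are indecomposable, and they are ALL the irreducible factors** —
`{Λ(η − η_C)⁰ | C a component of Θ(𝒯)} = polarizedComponents Φ η`, with `C ↦ Λ(η − η_C)⁰` injective; so
`𝒯` has exactly `#components(Θ(𝒯))` irreducible factors. [cite: ClemensGriffiths1972, §3 Lemma 3.20 and Cor. 3.23, pp. 296–297] -/
theorem IsPrincipalPolarization.range_orthSubspace_components_eq_polarizedComponents_thetaDivisor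
    (hP : IsPrincipalPolarization Φ η) (he : orientationSign Φ e = 1) (hχ : IsSemicharacter Φ η χ)
    (hϑ : ϑ ∈ thetaFunctions Φ (canonicalFactor Φ η χ)) {Θ : Set (ComplexTorus Φ)}
    (hΘ : HasPureDim 𝓘(ℂ, E) Θ q) (hzero : cover Φ ⁻¹' Θ = {w | ϑ w = 0})
    (ηC : {C : Set (ComplexTorus Φ) // IsIrreducibleComponent 𝓘(ℂ, E) Θ C} → E [⋀^Fin 2]→L[ℝ] ℝ)
    (hηC : ∀ C, IsNSForm Φ (ηC C) ∧ analyticCycleClass Φ e hq (C.2.hasPureDim hΘ) = ofRealForm (-ηC C)) :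
    (∀ C, IsIndecomposable Φ η (orthSubspace Φ (η - ηC C) ⊤)) ∧
      Set.range (fun C : {C : Set (ComplexTorus Φ) // IsIrreducibleComponent 𝓘(ℂ, E) Θ C} ↦
        orthSubspace Φ (η - ηC C) ⊤) = polarizedComponents Φ η ∧
      Injective (fun C : {C : Set (ComplexTorus Φ) // IsIrreducibleComponent 𝓘(ℂ, E) Θ C} ↦
        orthSubspace Φ (η - ηC C) ⊤) ∧
      {C : Set (ComplexTorus Φ) | IsIrreducibleComponent 𝓘(ℂ, E) Θ C}.ncard = (polarizedComponents Φ η).ncard ∧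
      {C : Set (ComplexTorus Φ) | IsIrreducibleComponent 𝓘(ℂ, E) Θ C}.ncard ≤ g := by
  have hcl := hP.analyticCycleClass_thetaDivisor_eq Φ e hq hχ hϑ he hΘ hzero
  exact ⟨fun C ↦ hP.isIndecomposable_orthSubspace_sub_component Φ e hq he hΘ hcl C.2 (hηC C).1 (hηC C).2,
    hP.range_orthSubspace_components_eq_polarizedComponents Φ e hq he hΘ hcl ηC hηC,
    hP.injective_orthSubspace_components Φ e hq he hΘ hcl ηC hηC,
    hP.ncard_components_eq_ncard_polarizedComponents Φ e hq he hΘ hcl,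
    hP.ncard_components_le Φ e hq he hΘ hcl⟩

end ThetaDivisor

end ComplexTorus

end Literature.Geometry.Kaehler

end
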